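import Summits.ABC.IUTFork.Repair.RHSlotReachWindowBed
import Summits.ABC.IUTFork.Repair.RHSlotReachLocal
import Summits.ABC.IUTFork.Cor312LicenceShallowRealising
import Summits.ABC.IUTFork.Cor312NotLicencePrVolSharpRealises
import Literature.IUT.LogVolume.RescaledCompletionInvariants
import HarnessLib

/-!
# R-H ROUND 2, Q2 «S restricted to Σ» for the HULL-REACH family (rows 15 ⊋ 8, 16, 18) — seat abc-iut-rh2-q2-hull:
# the landed door AT THE GENUINE BED with its dictionary binders DISCHARGED, globally (datum-strata Σ) and packet by packet (cell-strata Σ)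

PROOF-ONLY file (D-0012: 0 definitions, 0 `Prop` facts; abc-iut cell, rung LADDER-ABC:A2.RESCUE.H; seat abc-iut-rh2-q2-hull gen 0, R-H ROUND 2 Q2
per abc-iut-rh-lead 19:48:27Z / `plan/rescue/R-H/ROUND2/START-HERE.md` v1.0 §2 «∀ D, InSigma₁₅ D → S_H-window D by the landed door chain»). TAKES
NO SIDE on [IUTchIII] Cor. 3.12 or on any author (Mochizuki / Scholze–Stix / Joshi / Dupuy–Hilado); the slot-reach window
`RHSlotReach.SlotReachWindow(K)` (abc-iut-lens-wuc-1 / abc-iut-rh-typ-12, p457641) is an R-H CANDIDATE = a HYPOTHESIS SHAPE, never asserted; typed ≠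
proved; instantiated ≠ endorsed; nothing here asserts abc. The round-1 doors (row 15: p462301 mover, p463352 hSHw shape, p465892 packet by packet;
rows 8/16 by containment p460910 / p464040; row 18 p460671) conclude «`PilotKummerCompatHull (LatticeSituation.ofShells …) (settingPrVolSharp X …)
(fun _ => qRegion) qK`» for ANY pilot datum `X` MODULO DICTIONARY BINDERS (`hϖ` norm uniformizers, `hsharp`/`hrad` certificates, `ht1`/`hΘ`/`hq`/`htqle`
idele profile, `he`). At the GENUINE `K`-level datum `Cor312Prov.pilotDataOfK D K` with Θ- and q-ideles REALISING the pilot divisors ([IUTchI] Ex. 3.2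
(iv); log-form `ht`/`htq` = branch C's side conditions, inhabited by `Cor312Prov.exists_realising_{q,theta}Ideles_pilotDataOfK`) every binder is a
THEOREM of the tree (`exists_isUniformizer_rescaledCompletion`; `Thm311.Real.norm_{q,theta}Idele_eq_rpow_of_realises`; `norm_qIdele_le_one_of_realises`;
`ramIdx ≥ 1`), so what remains is EXACTLY the stratum datum: a CERTIFIED dictionary `(n₀, λ)` per place (one non-log-unit of norm `≤ p^{−(n₀−1)/e}`,
one log-unit of norm `≥ p^{λ}`), integer Kummer orders `m_q(w) = P_q(w)` at the bad places, and the window — globally («the datum lies in Σ₁₅»)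
or on a packet stratum `Σ` («S_H|Σ»).
* §1 (ANY `X`, def-free «S_H|Σ» shape) `qRegion_subset_thetaHull_settingPrVolSharp_of_slotReachOn`: clauses on a stratum `σ : primes → labels → Prop`
  ⟹ `qRegion j v_ℚ ⊆ ⁿ˒°𝒰_{j,v_ℚ}` at every packet of `Σ̂ := σ ∪ {label 0} ∪ {archimedean}` (the last two are free for integral `t_q`).
* §2 (genuine bed, REALISING ideles) `pilotKummerCompatHull_ofShells_pilotDataOfK_of_slotReachWindowK` («datum in Σ₁₅ ⟹ the hSHw body
  VERBATIM») and its Σ-local twin `qRegion_subset_thetaHull_pilotDataOfK_of_slotReachOn`.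
* companion `Repair/RH2SigmaHullChosen.lean`: the same at the CHOSEN ideles of `Conditional.abc_of_SH_v10K_window` + the certificate composition.
HONEST SCOPE. OUR typed objects ((Ind2) of Dupuy–Hilado = all `ℤ_p`-lattice automorphisms of the log-shell, STRONGER-THAN-PRINT; SHARP boxes;
hull-level reading of Step (xi-f)); «the hull clause follows from the window AS TYPED at the genuine bed», nothing more; no table cell is decided
here. [cite: DupuyHilado2025, §3.3, §3.4, §3.9, §4.9] [cite: WeilBNT1967, Ch. II §2, Th. 1] [cite: NeukirchANT1999, Ch. II Prop. (6.8)]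
[cite: Mochizuki2012, IUTchI Ex. 3.2 (iv) p. 71; IUTchIII Cor. 3.12 Step (xi-f) p. 184] [claim: Mochizuki2012, status: disputed]. Axioms: standard.
-/

noncomputable section

open Set Function
open scoped Pointwise

namespace Summit.ABC.IUTFork.Repair.RH2SigmaHull

open Thm311 Thm311.Real Cor312 Cor312.Setting Cor312Vol Cor312Prov Literature.IUT.LogThetaLattice Literature.IUT.LogVolume
  Literature.IUT.HodgeTheaters
open Literature.NumberTheory.NumberFields NumberField IsDedekindDomain Metric RHSlotReach RHSlotReachGlue RHSlotReachLocal

/-! ## §1. Any pilot datum: the Σ-local hull from the Σ-local clauses (def-free «S_H|Σ» shape) -/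

section Setting

variable {F : Type} [Field F] [NumberField F] (X : PilotData F) {logv : PadicLogs F} (hlog : LogvAnalytic logv)
  (M : Type) [Field M] [NumberField M]
  (archPk : ∀ (j : (thetaIndex X).Label) (vQ : (thetaIndex X).VQ), Set ((logShellsDH X logv).Packet j vQ))
  (archSub : ∀ (j : (thetaIndex X).Label) (v : (thetaIndex X).V),
    Set ((logShellsDH X logv).Packet j ((thetaIndex X).over v)))
  (Ψ : ℤ → ∀ v : (thetaIndex X).V, v ∈ (thetaIndex X).Vbad → Set ((logShellsDH X logv).StarPacket v))
  (act : ℤ → ∀ v : (thetaIndex X).V, v ∈ (thetaIndex X).Vbad →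
    (logShellsDH X logv).StarPacket v → Module.End ℚ ((logShellsDH X logv).StarPacket v))
  (Mmod : ℤ → ∀ j : (thetaIndex X).LabelStar, Set ((logShellsDH X logv).GlobalPacket j.1))
  (region : ℤ → ∀ j : (thetaIndex X).LabelStar, FinDivisor M → ∀ vQ : (thetaIndex X).VQ,
    Set ((logShellsDH X logv).Packet j.1 vQ))
  (n : ℤ) {HT : Type} {LogLink : HT → HT → Type} {IsFull : ∀ {s t : HT}, LogLink s t → Prop}
  (lat : LGPGaussianLogThetaLattice LogLink IsFull)
  {Frd : Type} {IsoF : Frd → Frd → Type} {Ob : Frd → Type} {realify : Frd → Frd} {Strip : Type}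
  {IsoS : Strip → Strip → Type} {Mv : ∀ v : (thetaIndex X).V, v ∈ (thetaIndex X).Vbad → Type}
  [∀ v h, Monoid (Mv v h)]
  (sig : GlobalLGPFrobenioidSignature (thetaIndex X).lstar (thetaIndex X).V (· ∈ (thetaIndex X).Vbad)
    Frd IsoF Ob realify Strip IsoS Mv)
  (split : SplittingMonoids Mv) {ObΔ : Type} {N : ∀ v : (thetaIndex X).V, v ∈ (thetaIndex X).Vbad → Type}
  [∀ v h, Monoid (N v h)] (qData : QPilotData ObΔ N)
  (tq : ∀ (pp : Nat.Primes) (x : (thetaIndex X).Fibre (.inr pp)), haveI : Fact (pp : ℕ).Prime := ⟨pp.2⟩; kOf X pp.1 x)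
  (t : ∀ (pp : Nat.Primes) (_ : Fin X.lstar) (x : (thetaIndex X).Fibre (.inr pp)),
    haveI : Fact (pp : ℕ).Prime := ⟨pp.2⟩; kOf X pp.1 x)
  (htq0 : ∀ pp x, tq pp x ≠ 0)
  (htq1 : ∀ (pp : Nat.Primes) (x : (thetaIndex X).Fibre (.inr pp)),
    haveI : Fact (pp : ℕ).Prime := ⟨pp.2⟩; placeOf X pp.1 x ∉ X.S → ‖tq pp x‖ = 1)
  -- the window's numeric dictionary (abc-iut-lens-wuc-1): ramification, inner conductor, outer radius, norm uniformizer, idele orders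
  (e n₀ : ∀ pp : Nat.Primes, (thetaIndex X).Fibre (.inr pp) → ℕ)
  (lam : ∀ pp : Nat.Primes, (thetaIndex X).Fibre (.inr pp) → ℝ)
  (ϖ : ∀ (pp : Nat.Primes) (x : (thetaIndex X).Fibre (.inr pp)), haveI : Fact (pp : ℕ).Prime := ⟨pp.2⟩; kOf X pp.1 x)
  (mΘ : ∀ pp : Nat.Primes, Fin (thetaIndex X).lstar → (thetaIndex X).Fibre (.inr pp) → ℤ)
  (mq : ∀ pp : Nat.Primes, (thetaIndex X).Fibre (.inr pp) → ℤ)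

/-- **S_H ON A PACKET STRATUM from the window ON THAT STRATUM (any pilot datum `X`, setting `settingPrVolSharp X …`).** `σ p i` = the stratum `Σ`
of packets `(i+1, p)`. If the slot-reach clauses hold on `Σ` (`hHσ`: for `σ p i`, every bad `w ∣ p`, every donor tuple), then — under the dictionary
binders of the door of record p463352 and integral `t_q` — `qRegion j v_ℚ ⊆ ⁿ˒°𝒰_{j,v_ℚ}` at every packet ALL of whose presentations `(i+1, p)` lie in
`Σ`: on `Σ` (abc-iut-rp-d3's packet door `RHSlotReachLocal.qRegion_subset_thetaHull_settingPrVolSharp_of_slotReachAt`, p465892), at the label `0`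
(identity movers, `exists_mover_of_norm_le`) and at the archimedean packets (`qRegion_subset_thetaHull_settingDHVolSharp_inl`) — the def-free «S_H|Σ»
shape on `Σ̂ = Σ ∪ {j = 0} ∪ {v_ℚ = ∞}`. [cite: DupuyHilado2025, §3.9, §4.9] [cite: WeilBNT1967, Ch. II §2, Th. 1] [claim: Mochizuki2012, status: disputed] -/
theorem qRegion_subset_thetaHull_settingPrVolSharp_of_slotReachOn (htqle : ∀ pp x, ‖tq pp x‖ ≤ 1)
    (he : ∀ pp x, 1 ≤ e pp x)
    (hϖ : ∀ (pp : Nat.Primes) (x : (thetaIndex X).Fibre (.inr pp)), haveI : Fact (pp : ℕ).Prime := ⟨pp.2⟩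
      ‖ϖ pp x‖ = (pp : ℝ) ^ (-(1 : ℝ) / (e pp x : ℝ)))
    (hsharp : ∀ (pp : Nat.Primes) (x : (thetaIndex X).Fibre (.inr pp)), haveI : Fact (pp : ℕ).Prime := ⟨pp.2⟩
      ∃ u : kOf X pp.1 x, ‖u‖ ≤ ‖ϖ pp x‖ ^ ((n₀ pp x : ℤ) - 1) ∧ u ∉ (logUnits (kOf X pp.1 x) : Set (kOf X pp.1 x)))
    (hrad : ∀ (pp : Nat.Primes) (x : (thetaIndex X).Fibre (.inr pp)), haveI : Fact (pp : ℕ).Prime := ⟨pp.2⟩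
      ∃ z ∈ (logUnits (kOf X pp.1 x) : Set (kOf X pp.1 x)), (pp : ℝ) ^ (lam pp x) ≤ ‖z‖)
    (ht1 : ∀ (pp : Nat.Primes) (i : Fin X.lstar) (x : (thetaIndex X).Fibre (.inr pp)),
      haveI : Fact (pp : ℕ).Prime := ⟨pp.2⟩; placeOf X pp.1 x ∉ X.S → ‖t pp i x‖ = 1)
    (hΘ : ∀ (pp : Nat.Primes) (i : Fin X.lstar) (w : (thetaIndex X).Fibre (.inr pp)), haveI : Fact (pp : ℕ).Prime := ⟨pp.2⟩
      placeOf X pp.1 w ∈ X.S → ‖t pp i w‖ = ‖ϖ pp w‖ ^ (mΘ pp i w))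
    (hq : ∀ (pp : Nat.Primes) (w : (thetaIndex X).Fibre (.inr pp)), haveI : Fact (pp : ℕ).Prime := ⟨pp.2⟩
      placeOf X pp.1 w ∈ X.S → ‖tq pp w‖ = ‖ϖ pp w‖ ^ (mq pp w))
    (σ : Nat.Primes → Fin (thetaIndex X).lstar → Prop)
    (hHσ : ∀ (pp : Nat.Primes) (i : Fin (thetaIndex X).lstar), σ pp i →
      ∀ w : (thetaIndex X).Fibre (.inr pp), haveI : Fact (pp : ℕ).Prime := ⟨pp.2⟩; placeOf X pp.1 w ∈ X.S →
        ∀ x : Fin ((i : ℕ) + 1) → (thetaIndex X).Fibre (.inr pp),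
          (((mΘ pp i w - n₀ pp w) / (e pp w : ℤ) : ℤ) : ℝ)
            ≤ (mq pp w : ℝ) / (e pp w : ℝ) + lam pp w
              + ∑ a, (lam pp (x a) + ((-((-(n₀ pp (x a) : ℤ)) / (e pp (x a) : ℤ)) : ℤ) : ℝ)))
    (j : (thetaIndex X).Label) (vQ : (thetaIndex X).VQ)
    (hjv : ∀ (pp : Nat.Primes) (i : Fin (thetaIndex X).lstar), vQ = .inr pp → j = Setting.labelSucc i → σ pp i) :
    (settingPrVolSharp X hlog M archPk archSub Ψ act Mmod region n lat sig split qData tq t htq0 htq1).qRegion j vQ ⊆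
      (settingPrVolSharp X hlog M archPk archSub Ψ act Mmod region n lat sig split qData tq t htq0 htq1).thetaHull j vQ := by
  haveI hne : ∀ pp : Nat.Primes, Fact (pp : ℕ).Prime := fun pp => ⟨pp.2⟩
  by_cases hj : 0 < (j : ℕ)
  · -- a label of `𝔽_l^⋇`
    have hj' : j = labelSucc ⟨(j : ℕ) - 1, by have := j.2; simp only [thetaIndex] at this ⊢; omega⟩ := by
      ext; simp only [labelSucc, Fin.val_succ]; omega
    cases vQ with
    | inl u =>
      rw [hj']
      exact qRegion_subset_thetaHull_settingDHVolSharp_inl X hlog M archPk archSub Ψ act Mmod region n lat sig split qData tq t htq0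
        htq1 (labelSucc _) u
    | inr pp =>
      have hσ : σ pp ⟨(j : ℕ) - 1, by have := j.2; simp only [thetaIndex] at this ⊢; omega⟩ := hjv pp _ rfl hj'
      rw [hj']
      exact qRegion_subset_thetaHull_settingPrVolSharp_of_slotReachAt X hlog M archPk archSub Ψ act Mmod region n lat sig split qData
        tq t htq0 e n₀ lam ϖ mΘ mq htq1 he hϖ hsharp hrad ht1 hΘ hq pp _ (hHσ pp _ hσ)
  · -- the label `0`: the Θ-idele is `1`, identity movers for integral `t_q`
    refine qRegion_subset_thetaHull_settingDHVolSharp_of_movers X hlog M archPk archSub Ψ act Mmod region n lat sig split qData tq t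
      htq0 htq1 j vQ fun pp x => exists_mover_of_norm_le X hlog tq t pp j x ?_
    unfold labelIdele
    rw [dif_neg hj, norm_one]
    exact htqle pp x

/-- **Certificate shape at `Σ = ⊤`**: if `σ p i` everywhere, the hSHw clause «`PilotKummerCompatHull (LatticeSituation.ofShells …) (settingPrVolSharp X …)
(fun _ => qRegion) qK`» holds (any columns, any `qK`) — the Σ-local theorem is visibly the door p463352 at `Σ = ⊤`. [claim: Mochizuki2012, status: disputed] -/
theorem pilotKummerCompatHull_ofShells_settingPrVolSharp_of_slotReachOn_top
    (frobAdm : ℤ → ℤ → ∀ (j : (thetaIndex X).Label) (vQ : (thetaIndex X).VQ), Set ((logShellsDH X logv).Packet j vQ) → Prop)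
    (frobLogvol : ℤ → ℤ → ∀ (j : (thetaIndex X).Label) (vQ : (thetaIndex X).VQ), Set ((logShellsDH X logv).Packet j vQ) → ℝ)
    (frobΨ : ℤ → ℤ → ∀ v : (thetaIndex X).V, v ∈ (thetaIndex X).Vbad → Set ((logShellsDH X logv).StarPacket v))
    (frobMmod : ℤ → ℤ → ∀ j : (thetaIndex X).LabelStar, Set ((logShellsDH X logv).GlobalPacket j.1))
    (unitImage : ℤ → ℤ → ℕ → ∀ (j : (thetaIndex X).Label) (vQ : (thetaIndex X).VQ), Set ((logShellsDH X logv).Packet j vQ))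
    (ballImage : ℤ → ℤ → ∀ (j : (thetaIndex X).Label) (vQ : (thetaIndex X).VQ), Set ((logShellsDH X logv).Packet j vQ))
    (thetaDiv : ℤ → ℤ → LgpDivisor M (thetaIndex X).lstar)
    (qK : ∀ v : (thetaIndex X).V, v ∈ (thetaIndex X).Vbad → Set ((logShellsDH X logv).StarPacket v))
    (htqle : ∀ pp x, ‖tq pp x‖ ≤ 1)
    (he : ∀ pp x, 1 ≤ e pp x)
    (hϖ : ∀ (pp : Nat.Primes) (x : (thetaIndex X).Fibre (.inr pp)), haveI : Fact (pp : ℕ).Prime := ⟨pp.2⟩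
      ‖ϖ pp x‖ = (pp : ℝ) ^ (-(1 : ℝ) / (e pp x : ℝ)))
    (hsharp : ∀ (pp : Nat.Primes) (x : (thetaIndex X).Fibre (.inr pp)), haveI : Fact (pp : ℕ).Prime := ⟨pp.2⟩
      ∃ u : kOf X pp.1 x, ‖u‖ ≤ ‖ϖ pp x‖ ^ ((n₀ pp x : ℤ) - 1) ∧ u ∉ (logUnits (kOf X pp.1 x) : Set (kOf X pp.1 x)))
    (hrad : ∀ (pp : Nat.Primes) (x : (thetaIndex X).Fibre (.inr pp)), haveI : Fact (pp : ℕ).Prime := ⟨pp.2⟩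
      ∃ z ∈ (logUnits (kOf X pp.1 x) : Set (kOf X pp.1 x)), (pp : ℝ) ^ (lam pp x) ≤ ‖z‖)
    (ht1 : ∀ (pp : Nat.Primes) (i : Fin X.lstar) (x : (thetaIndex X).Fibre (.inr pp)),
      haveI : Fact (pp : ℕ).Prime := ⟨pp.2⟩; placeOf X pp.1 x ∉ X.S → ‖t pp i x‖ = 1)
    (hΘ : ∀ (pp : Nat.Primes) (i : Fin X.lstar) (w : (thetaIndex X).Fibre (.inr pp)), haveI : Fact (pp : ℕ).Prime := ⟨pp.2⟩
      placeOf X pp.1 w ∈ X.S → ‖t pp i w‖ = ‖ϖ pp w‖ ^ (mΘ pp i w))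
    (hq : ∀ (pp : Nat.Primes) (w : (thetaIndex X).Fibre (.inr pp)), haveI : Fact (pp : ℕ).Prime := ⟨pp.2⟩
      placeOf X pp.1 w ∈ X.S → ‖tq pp w‖ = ‖ϖ pp w‖ ^ (mq pp w))
    (σ : Nat.Primes → Fin (thetaIndex X).lstar → Prop) (hσ : ∀ pp i, σ pp i)
    (hHσ : ∀ (pp : Nat.Primes) (i : Fin (thetaIndex X).lstar), σ pp i →
      ∀ w : (thetaIndex X).Fibre (.inr pp), haveI : Fact (pp : ℕ).Prime := ⟨pp.2⟩; placeOf X pp.1 w ∈ X.S →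
        ∀ x : Fin ((i : ℕ) + 1) → (thetaIndex X).Fibre (.inr pp),
          (((mΘ pp i w - n₀ pp w) / (e pp w : ℤ) : ℤ) : ℝ)
            ≤ (mq pp w : ℝ) / (e pp w : ℝ) + lam pp w
              + ∑ a, (lam pp (x a) + ((-((-(n₀ pp (x a) : ℤ)) / (e pp (x a) : ℤ)) : ℤ) : ℝ))) :
    PilotKummerCompatHull
      (LatticeSituation.ofShells (logShellsDH X logv) M archPk archSub (summandPiecesPr X hlog).Adm (summandPiecesPr X hlog).logvol
        Ψ act Mmod region frobAdm frobLogvol frobΨ frobMmod unitImage ballImage thetaDiv)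
      (settingPrVolSharp X hlog M archPk archSub Ψ act Mmod region n lat sig split qData tq t htq0 htq1)
      (fun _ => (settingPrVolSharp X hlog M archPk archSub Ψ act Mmod region n lat sig split qData tq t htq0 htq1).qRegion) qK :=
  fun j vQ =>
    qRegion_subset_thetaHull_settingPrVolSharp_of_slotReachOn X hlog M archPk archSub Ψ act Mmod region n lat sig split qData tq t htq0
      htq1 e n₀ lam ϖ mΘ mq htqle he hϖ hsharp hrad ht1 hΘ hq σ hHσ j vQ fun pp i _ _ => hσ pp i

end Setting

/-! ## §2. The genuine `K`-level bed `pilotDataOfK D K` with REALISING ideles: the dictionary binders discharged -/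

section Genuine

variable {F K Fbar : Type} [Field F] [NumberField F] [Field K] [NumberField K] [Algebra F K] [Field Fbar]
  [Algebra F Fbar] [Algebra K Fbar] {E : WeierstrassCurve F} [E.IsElliptic] {l : ℕ} {Pb : BadPlacePredicates K}
  (D : InitialThetaData F K Fbar E l Pb) {logv : PadicLogs K} (hlog : LogvAnalytic logv)
  (M : Type) [Field M] [NumberField M]
  (archPk : ∀ (j : (thetaIndex (pilotDataOfK D K)).Label) (vQ : (thetaIndex (pilotDataOfK D K)).VQ),
    Set ((logShellsDH (pilotDataOfK D K) logv).Packet j vQ))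
  (archSub : ∀ (j : (thetaIndex (pilotDataOfK D K)).Label) (v : (thetaIndex (pilotDataOfK D K)).V),
    Set ((logShellsDH (pilotDataOfK D K) logv).Packet j ((thetaIndex (pilotDataOfK D K)).over v)))
  (Ψ : ℤ → ∀ v : (thetaIndex (pilotDataOfK D K)).V, v ∈ (thetaIndex (pilotDataOfK D K)).Vbad →
    Set ((logShellsDH (pilotDataOfK D K) logv).StarPacket v))
  (act : ℤ → ∀ v : (thetaIndex (pilotDataOfK D K)).V, v ∈ (thetaIndex (pilotDataOfK D K)).Vbad →
    (logShellsDH (pilotDataOfK D K) logv).StarPacket v → Module.End ℚ ((logShellsDH (pilotDataOfK D K) logv).StarPacket v))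
  (Mmod : ℤ → ∀ j : (thetaIndex (pilotDataOfK D K)).LabelStar, Set ((logShellsDH (pilotDataOfK D K) logv).GlobalPacket j.1))
  (region : ℤ → ∀ j : (thetaIndex (pilotDataOfK D K)).LabelStar, FinDivisor M → ∀ vQ : (thetaIndex (pilotDataOfK D K)).VQ,
    Set ((logShellsDH (pilotDataOfK D K) logv).Packet j.1 vQ))
  (frobAdm : ℤ → ℤ → ∀ (j : (thetaIndex (pilotDataOfK D K)).Label) (vQ : (thetaIndex (pilotDataOfK D K)).VQ),
    Set ((logShellsDH (pilotDataOfK D K) logv).Packet j vQ) → Prop)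
  (frobLogvol : ℤ → ℤ → ∀ (j : (thetaIndex (pilotDataOfK D K)).Label) (vQ : (thetaIndex (pilotDataOfK D K)).VQ),
    Set ((logShellsDH (pilotDataOfK D K) logv).Packet j vQ) → ℝ)
  (frobΨ : ℤ → ℤ → ∀ v : (thetaIndex (pilotDataOfK D K)).V, v ∈ (thetaIndex (pilotDataOfK D K)).Vbad →
    Set ((logShellsDH (pilotDataOfK D K) logv).StarPacket v))
  (frobMmod : ℤ → ℤ → ∀ j : (thetaIndex (pilotDataOfK D K)).LabelStar, Set ((logShellsDH (pilotDataOfK D K) logv).GlobalPacket j.1))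
  (unitImage : ℤ → ℤ → ℕ → ∀ (j : (thetaIndex (pilotDataOfK D K)).Label) (vQ : (thetaIndex (pilotDataOfK D K)).VQ),
    Set ((logShellsDH (pilotDataOfK D K) logv).Packet j vQ))
  (ballImage : ℤ → ℤ → ∀ (j : (thetaIndex (pilotDataOfK D K)).Label) (vQ : (thetaIndex (pilotDataOfK D K)).VQ),
    Set ((logShellsDH (pilotDataOfK D K) logv).Packet j vQ))
  (thetaDiv : ℤ → ℤ → LgpDivisor M (thetaIndex (pilotDataOfK D K)).lstar)
  (n : ℤ) {HT : Type} {LogLink : HT → HT → Type} {IsFull : ∀ {s t : HT}, LogLink s t → Prop}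
  (lat : LGPGaussianLogThetaLattice LogLink IsFull)
  {Frd : Type} {IsoF : Frd → Frd → Type} {Ob : Frd → Type} {realify : Frd → Frd} {Strip : Type}
  {IsoS : Strip → Strip → Type}
  {Mv : ∀ v : (thetaIndex (pilotDataOfK D K)).V, v ∈ (thetaIndex (pilotDataOfK D K)).Vbad → Type} [∀ v h, Monoid (Mv v h)]
  (sig : GlobalLGPFrobenioidSignature (thetaIndex (pilotDataOfK D K)).lstar (thetaIndex (pilotDataOfK D K)).V
    (· ∈ (thetaIndex (pilotDataOfK D K)).Vbad) Frd IsoF Ob realify Strip IsoS Mv)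
  (split : SplittingMonoids Mv) {ObΔ : Type}
  {N : ∀ v : (thetaIndex (pilotDataOfK D K)).V, v ∈ (thetaIndex (pilotDataOfK D K)).Vbad → Type} [∀ v h, Monoid (N v h)]
  (qData : QPilotData ObΔ N)
  (qK : ∀ v : (thetaIndex (pilotDataOfK D K)).V, v ∈ (thetaIndex (pilotDataOfK D K)).Vbad →
    Set ((logShellsDH (pilotDataOfK D K) logv).StarPacket v))
  (tq : ∀ (pp : Nat.Primes) (x : (thetaIndex (pilotDataOfK D K)).Fibre (.inr pp)),
    haveI : Fact (pp : ℕ).Prime := ⟨pp.2⟩; kOf (pilotDataOfK D K) pp.1 x)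
  (t : ∀ (pp : Nat.Primes) (_ : Fin (pilotDataOfK D K).lstar) (x : (thetaIndex (pilotDataOfK D K)).Fibre (.inr pp)),
    haveI : Fact (pp : ℕ).Prime := ⟨pp.2⟩; kOf (pilotDataOfK D K) pp.1 x)
  (htq0 : ∀ pp x, tq pp x ≠ 0)
  (htq1 : ∀ (pp : Nat.Primes) (x : (thetaIndex (pilotDataOfK D K)).Fibre (.inr pp)),
    haveI : Fact (pp : ℕ).Prime := ⟨pp.2⟩; placeOf (pilotDataOfK D K) pp.1 x ∉ (pilotDataOfK D K).S → ‖tq pp x‖ = 1)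
  (ht0 : ∀ pp i x, t pp i x ≠ 0)
  (ht1 : ∀ (pp : Nat.Primes) (i : Fin (pilotDataOfK D K).lstar) (x : (thetaIndex (pilotDataOfK D K)).Fibre (.inr pp)),
    haveI : Fact (pp : ℕ).Prime := ⟨pp.2⟩; placeOf (pilotDataOfK D K) pp.1 x ∉ (pilotDataOfK D K).S → ‖t pp i x‖ = 1)
  (ht : ∀ (pp : Nat.Primes) (i : Fin (pilotDataOfK D K).lstar) (x : (thetaIndex (pilotDataOfK D K)).Fibre (.inr pp)),
    haveI : Fact (pp : ℕ).Prime := ⟨pp.2⟩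
    Real.log ‖t pp i x‖ = -((pilotDataOfK D K).thetaPilot i (placeOf (pilotDataOfK D K) pp.1 x)) *
      logNorm K (placeOf (pilotDataOfK D K) pp.1 x) / localDegree K (placeOf (pilotDataOfK D K) pp.1 x))
  (htq : ∀ (pp : Nat.Primes) (x : (thetaIndex (pilotDataOfK D K)).Fibre (.inr pp)),
    haveI : Fact (pp : ℕ).Prime := ⟨pp.2⟩
    Real.log ‖tq pp x‖ = -((pilotDataOfK D K).qPilot (placeOf (pilotDataOfK D K) pp.1 x)) *
      logNorm K (placeOf (pilotDataOfK D K) pp.1 x) / localDegree K (placeOf (pilotDataOfK D K) pp.1 x))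
  (n₀ : ∀ pp : Nat.Primes, (thetaIndex (pilotDataOfK D K)).Fibre (.inr pp) → ℕ)
  (lam : ∀ pp : Nat.Primes, (thetaIndex (pilotDataOfK D K)).Fibre (.inr pp) → ℝ)
  (mq : ∀ pp : Nat.Primes, (thetaIndex (pilotDataOfK D K)).Fibre (.inr pp) → ℤ)

/-- The ramification dictionary of the genuine bed `e_x := ramIdx K (placeOf x) = e(K_x/ℚ_p)` has `1 ≤ e_x`. [cite: NeukirchANT1999, Ch. II Prop. (6.8)] -/
theorem one_le_ramIdx_placeOf (pp : Nat.Primes) (x : (thetaIndex (pilotDataOfK D K)).Fibre (.inr pp)) :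
    haveI : Fact (pp : ℕ).Prime := ⟨pp.2⟩; 1 ≤ ramIdx K (placeOf (pilotDataOfK D K) pp.1 x) :=
  Nat.one_le_iff_ne_zero.2 (ramIdx_ne_zero K _)

/-- **A NORM-UNIFORMIZER DICTIONARY EXISTS on the genuine bed**: every `x ∣ p` of `K` has some `ϖ_x ∈ K_x` with `‖ϖ_x‖ = p^{−1/e_x}`, `e_x = ramIdx K
(placeOf x)` (`exists_isUniformizer_rescaledCompletion`) — the door's binder `hϖ` is a theorem here. [cite: NeukirchANT1999, Ch. II Prop. (6.8)] -/
theorem exists_normUniformizers :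
    ∃ ϖ : ∀ (pp : Nat.Primes) (x : (thetaIndex (pilotDataOfK D K)).Fibre (.inr pp)),
        haveI : Fact (pp : ℕ).Prime := ⟨pp.2⟩; kOf (pilotDataOfK D K) pp.1 x,
      ∀ (pp : Nat.Primes) (x : (thetaIndex (pilotDataOfK D K)).Fibre (.inr pp)), haveI : Fact (pp : ℕ).Prime := ⟨pp.2⟩
        ‖ϖ pp x‖ = (pp : ℝ) ^ (-(1 : ℝ) / (ramIdx K (placeOf (pilotDataOfK D K) pp.1 x) : ℝ)) := by
  haveI hne : ∀ pp : Nat.Primes, Fact (pp : ℕ).Prime := fun pp => ⟨pp.2⟩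
  have h : ∀ (pp : Nat.Primes) (x : (thetaIndex (pilotDataOfK D K)).Fibre (.inr pp)),
      ∃ ϖ : kOf (pilotDataOfK D K) pp.1 x, ‖ϖ‖ = (pp : ℝ) ^ (-(1 : ℝ) / (ramIdx K (placeOf (pilotDataOfK D K) pp.1 x) : ℝ)) := by
    intro pp x
    obtain ⟨ϖ, -, hnorm⟩ := exists_isUniformizer_rescaledCompletion K pp.1 (placeOf (pilotDataOfK D K) pp.1 x)
      (natCast_mem_placeOf (pilotDataOfK D K) pp.1 x)
    refine ⟨(ϖ : kOf (pilotDataOfK D K) pp.1 x), ?_⟩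
    rw [hnorm, ramIdx_eq K (placeOf (pilotDataOfK D K) pp.1 x), neg_div]
  choose ϖ hϖ using h
  exact ⟨ϖ, hϖ⟩

/-- `‖ϖ‖^m = p^{−m/e}` for a norm uniformizer `‖ϖ‖ = p^{−1/e}` and an integer exponent `m`. [folklore] -/
theorem zpow_of_norm_eq_rpow {R : Type*} [NormedDivisionRing R] {p : ℕ} (hp : 0 < p) {e : ℕ} {ϖ : R}
    (hϖ : ‖ϖ‖ = (p : ℝ) ^ (-(1 : ℝ) / (e : ℝ))) (m : ℤ) :
    ‖ϖ‖ ^ m = (p : ℝ) ^ (-(m : ℝ) / (e : ℝ)) := by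
  have hp0 : (0 : ℝ) < (p : ℝ) := by exact_mod_cast hp
  rw [← Real.rpow_intCast, hϖ, ← Real.rpow_mul hp0.le]
  congr 1; ring

include htq0 htq in
/-- **`‖t_{q,w}‖ = ‖ϖ_w‖^{m_q(w)}` at a bad place** for a REALISING q-idele, a norm uniformizer `ϖ_w` and the INTEGER Kummer order `m_q(w) = P_q(w)`
(`Thm311.Real.norm_qIdele_eq_rpow_of_realises`, Dupuy–Hilado (3.4)) — the door's binder `hq` is a theorem here. [cite: DupuyHilado2025, §3.4] -/
theorem norm_qIdele_eq_zpow_of_realises (pp : Nat.Primes) (w : (thetaIndex (pilotDataOfK D K)).Fibre (.inr pp))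
    (ϖw : haveI : Fact (pp : ℕ).Prime := ⟨pp.2⟩; kOf (pilotDataOfK D K) pp.1 w)
    (hϖ : haveI : Fact (pp : ℕ).Prime := ⟨pp.2⟩
      ‖ϖw‖ = (pp : ℝ) ^ (-(1 : ℝ) / (ramIdx K (placeOf (pilotDataOfK D K) pp.1 w) : ℝ)))
    (hmq : haveI : Fact (pp : ℕ).Prime := ⟨pp.2⟩; (mq pp w : ℝ) = (pilotDataOfK D K).qPilot (placeOf (pilotDataOfK D K) pp.1 w)) :
    haveI : Fact (pp : ℕ).Prime := ⟨pp.2⟩; ‖tq pp w‖ = ‖ϖw‖ ^ (mq pp w) := by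
  haveI : Fact (pp : ℕ).Prime := ⟨pp.2⟩
  rw [zpow_of_norm_eq_rpow pp.2.pos hϖ, norm_qIdele_eq_rpow_of_realises (pilotDataOfK D K) tq htq0 htq pp w, ← hmq, neg_div]

include ht0 ht htq0 htq in
/-- **`‖t_{Θ,i+1,w}‖ = ‖ϖ_w‖^{(i+1)²·m_q(w)}` at a bad place** for REALISING ideles (`P_Θ = (i+1)²·P_q`,
`Thm311.Real.norm_thetaIdele_eq_rpow_of_realises`) — the door's binder `hΘ` at the realising profile `m_Θ = j²·m_q` is a theorem here.
[cite: DupuyHilado2025, §3.3, §3.4] [cite: Mochizuki2012, IUTchI Ex. 3.2 (iv) p. 71] -/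
theorem norm_thetaIdele_eq_zpow_of_realises (pp : Nat.Primes) (i : Fin (pilotDataOfK D K).lstar)
    (w : (thetaIndex (pilotDataOfK D K)).Fibre (.inr pp))
    (ϖw : haveI : Fact (pp : ℕ).Prime := ⟨pp.2⟩; kOf (pilotDataOfK D K) pp.1 w)
    (hϖ : haveI : Fact (pp : ℕ).Prime := ⟨pp.2⟩
      ‖ϖw‖ = (pp : ℝ) ^ (-(1 : ℝ) / (ramIdx K (placeOf (pilotDataOfK D K) pp.1 w) : ℝ)))
    (hmq : haveI : Fact (pp : ℕ).Prime := ⟨pp.2⟩; (mq pp w : ℝ) = (pilotDataOfK D K).qPilot (placeOf (pilotDataOfK D K) pp.1 w)) :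
    haveI : Fact (pp : ℕ).Prime := ⟨pp.2⟩; ‖t pp i w‖ = ‖ϖw‖ ^ (((((i : ℕ) : ℤ) + 1) ^ 2) * mq pp w) := by
  haveI : Fact (pp : ℕ).Prime := ⟨pp.2⟩
  rw [zpow_of_norm_eq_rpow pp.2.pos hϖ, norm_thetaIdele_eq_rpow_of_realises (pilotDataOfK D K) tq t htq0 ht0 ht htq pp i w, ← hmq,
    neg_div, neg_div]
  congr 2
  push_cast
  ring

include ht0 ht1 ht htq in
/-- **«DATUM IN Σ₁₅ ⟹ S_H-WINDOW VERBATIM» — the row-15 door at the GENUINE BED with REALISING ideles, dictionary binders DISCHARGED.**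
At `Cor312Prov.pilotDataOfK D K` ([IUTchI] Ex. 3.2 (iv)) with Θ- and q-ideles realising the pilot divisors in `K_w` (log-form `ht`/`htq`, units off
`S`: branch C's side conditions, inhabited by `Cor312Prov.exists_realising_{q,theta}Ideles_pilotDataOfK`): IF the datum carries a CERTIFIED window
dictionary — per place an inner bound `n₀(x)` (one NON-log-unit of norm `≤ p^{−(n₀(x)−1)/e_x}`), an outer radius `λ(x)` (one log-unit of norm `≥ p^{λ(x)}`),
integer Kummer orders `m_q(w) = P_q(w)` at the bad places — for which abc-iut-lens-wuc-1's `RHSlotReach.SlotReachWindowK D ramIdx n₀ λ (j²·m_q) m_q`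
holds, THEN `PilotKummerCompatHull (LatticeSituation.ofShells …) (settingPrVolSharp (pilotDataOfK D K) … tq t …) (fun _ => qRegion) qK` — the BODY of
the binder `hSHw` of `Conditional.abc_of_SH_v10K_window` (p447945) at this datum (ANY columns, ANY `qK`). PROOF = the door p463352 (mover p462301) with
`hϖ` := `exists_normUniformizers`, `hq`/`hΘ` := the realising profile, `htqle` := `norm_qIdele_le_one_of_realises`, `he` := `ramIdx ≥ 1`, `hsharp`/`hrad` :=
the certificates through `‖ϖ_x‖ = p^{−1/e_x}`. The window is a HYPOTHESIS; no side taken. [cite: DupuyHilado2025, §3.3, §3.4, §3.9, §4.9]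
[cite: NeukirchANT1999, Ch. II Prop. (6.8)] [cite: Mochizuki2012, IUTchI Ex. 3.2 (iv) p. 71; IUTchIII Cor. 3.12 Step (xi-f) p. 184] [claim: Mochizuki2012, status: disputed] -/
theorem pilotKummerCompatHull_ofShells_pilotDataOfK_of_slotReachWindowK
    (hn₀ : ∀ (pp : Nat.Primes) (x : (thetaIndex (pilotDataOfK D K)).Fibre (.inr pp)), haveI : Fact (pp : ℕ).Prime := ⟨pp.2⟩
      ∃ u : kOf (pilotDataOfK D K) pp.1 x,
        ‖u‖ ≤ (pp : ℝ) ^ (-(((n₀ pp x : ℤ) - 1 : ℤ) : ℝ) / (ramIdx K (placeOf (pilotDataOfK D K) pp.1 x) : ℝ)) ∧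
          u ∉ (logUnits (kOf (pilotDataOfK D K) pp.1 x) : Set (kOf (pilotDataOfK D K) pp.1 x)))
    (hlam : ∀ (pp : Nat.Primes) (x : (thetaIndex (pilotDataOfK D K)).Fibre (.inr pp)), haveI : Fact (pp : ℕ).Prime := ⟨pp.2⟩
      ∃ z ∈ (logUnits (kOf (pilotDataOfK D K) pp.1 x) : Set (kOf (pilotDataOfK D K) pp.1 x)), (pp : ℝ) ^ (lam pp x) ≤ ‖z‖)
    (hmq : ∀ (pp : Nat.Primes) (w : (thetaIndex (pilotDataOfK D K)).Fibre (.inr pp)), haveI : Fact (pp : ℕ).Prime := ⟨pp.2⟩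
      placeOf (pilotDataOfK D K) pp.1 w ∈ (pilotDataOfK D K).S →
        (mq pp w : ℝ) = (pilotDataOfK D K).qPilot (placeOf (pilotDataOfK D K) pp.1 w))
    (hH : SlotReachWindowK D (fun pp x => haveI : Fact (pp : ℕ).Prime := ⟨pp.2⟩; ramIdx K (placeOf (pilotDataOfK D K) pp.1 x)) n₀ lam
      (fun pp i w => ((((i : ℕ) : ℤ) + 1) ^ 2) * mq pp w) mq) :
    PilotKummerCompatHull
      (LatticeSituation.ofShells (logShellsDH (pilotDataOfK D K) logv) M archPk archSub (summandPiecesPr (pilotDataOfK D K) hlog).Adm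
        (summandPiecesPr (pilotDataOfK D K) hlog).logvol Ψ act Mmod region frobAdm frobLogvol frobΨ frobMmod unitImage ballImage thetaDiv)
      (settingPrVolSharp (pilotDataOfK D K) hlog M archPk archSub Ψ act Mmod region n lat sig split qData tq t htq0 htq1)
      (fun _ => (settingPrVolSharp (pilotDataOfK D K) hlog M archPk archSub Ψ act Mmod region n lat sig split qData tq t htq0 htq1).qRegion)
      qK := by
  haveI hne : ∀ pp : Nat.Primes, Fact (pp : ℕ).Prime := fun pp => ⟨pp.2⟩
  obtain ⟨ϖ, hϖ⟩ := exists_normUniformizers D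
  refine pilotKummerCompatHull_ofShells_settingPrVolSharp_of_slotReachWindow (pilotDataOfK D K) hlog M archPk archSub Ψ act Mmod region n
    lat sig split qData tq t htq0 htq1 (fun pp x => ramIdx K (placeOf (pilotDataOfK D K) pp.1 x)) n₀ lam ϖ
    (fun pp i w => ((((i : ℕ) : ℤ) + 1) ^ 2) * mq pp w) mq frobAdm frobLogvol frobΨ frobMmod unitImage ballImage thetaDiv qK
    (fun pp x => norm_qIdele_le_one_of_realises (pilotDataOfK D K) tq htq0 htq pp x) (fun pp x => one_le_ramIdx_placeOf D pp x) hϖ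
    (fun pp x => ?_) hlam ht1 (fun pp i w hw => norm_thetaIdele_eq_zpow_of_realises D tq t htq0 ht0 ht htq mq pp i w (ϖ pp w) (hϖ pp w)
      (hmq pp w hw)) (fun pp w hw => norm_qIdele_eq_zpow_of_realises D tq htq0 htq mq pp w (ϖ pp w) (hϖ pp w) (hmq pp w hw))
    ((slotReachWindowK_iff D _ _ _ _ _).1 hH)
  -- `hsharp`: the inner certificate through `‖ϖ_x‖^{n₀−1} = p^{−(n₀−1)/e_x}`
  obtain ⟨u, hu, hu'⟩ := hn₀ pp x
  refine ⟨u, ?_, hu'⟩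
  rw [zpow_of_norm_eq_rpow pp.2.pos (hϖ pp x)]
  exact hu

include ht0 ht1 ht htq in
/-- **«S_H ON Σ» at the GENUINE BED with REALISING ideles, dictionary binders DISCHARGED** (Σ-local twin of
`pilotKummerCompatHull_ofShells_pilotDataOfK_of_slotReachWindowK`): for a packet stratum `σ p i`, the slot-reach clauses of the datum's certified
dictionary ON `Σ` give the (xi-f) inclusion `qRegion j v_ℚ ⊆ ⁿ˒°𝒰_{j,v_ℚ}` of `settingPrVolSharp (pilotDataOfK D K) … tq t …` at every packet of
`Σ̂ = Σ ∪ {j = 0} ∪ {v_ℚ = ∞}` (§1 at this bed). For CELL-strata rows this is the `S_H|Σ` input of the weakened-Cor-3.12 target (rh2-q2-cond);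
the off-Σ packets are exactly those NOT claimed. [cite: DupuyHilado2025, §3.9, §4.9] [claim: Mochizuki2012, status: disputed] -/
theorem qRegion_subset_thetaHull_pilotDataOfK_of_slotReachOn
    (hn₀ : ∀ (pp : Nat.Primes) (x : (thetaIndex (pilotDataOfK D K)).Fibre (.inr pp)), haveI : Fact (pp : ℕ).Prime := ⟨pp.2⟩
      ∃ u : kOf (pilotDataOfK D K) pp.1 x,
        ‖u‖ ≤ (pp : ℝ) ^ (-(((n₀ pp x : ℤ) - 1 : ℤ) : ℝ) / (ramIdx K (placeOf (pilotDataOfK D K) pp.1 x) : ℝ)) ∧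
          u ∉ (logUnits (kOf (pilotDataOfK D K) pp.1 x) : Set (kOf (pilotDataOfK D K) pp.1 x)))
    (hlam : ∀ (pp : Nat.Primes) (x : (thetaIndex (pilotDataOfK D K)).Fibre (.inr pp)), haveI : Fact (pp : ℕ).Prime := ⟨pp.2⟩
      ∃ z ∈ (logUnits (kOf (pilotDataOfK D K) pp.1 x) : Set (kOf (pilotDataOfK D K) pp.1 x)), (pp : ℝ) ^ (lam pp x) ≤ ‖z‖)
    (hmq : ∀ (pp : Nat.Primes) (w : (thetaIndex (pilotDataOfK D K)).Fibre (.inr pp)), haveI : Fact (pp : ℕ).Prime := ⟨pp.2⟩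
      placeOf (pilotDataOfK D K) pp.1 w ∈ (pilotDataOfK D K).S →
        (mq pp w : ℝ) = (pilotDataOfK D K).qPilot (placeOf (pilotDataOfK D K) pp.1 w))
    (σ : Nat.Primes → Fin (thetaIndex (pilotDataOfK D K)).lstar → Prop)
    (hHσ : ∀ (pp : Nat.Primes) (i : Fin (thetaIndex (pilotDataOfK D K)).lstar), σ pp i →
      ∀ w : (thetaIndex (pilotDataOfK D K)).Fibre (.inr pp), haveI : Fact (pp : ℕ).Prime := ⟨pp.2⟩;
        placeOf (pilotDataOfK D K) pp.1 w ∈ (pilotDataOfK D K).S →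
        ∀ x : Fin ((i : ℕ) + 1) → (thetaIndex (pilotDataOfK D K)).Fibre (.inr pp),
          (((((((i : ℕ) : ℤ) + 1) ^ 2) * mq pp w - n₀ pp w) / (ramIdx K (placeOf (pilotDataOfK D K) pp.1 w) : ℤ) : ℤ) : ℝ)
            ≤ (mq pp w : ℝ) / (ramIdx K (placeOf (pilotDataOfK D K) pp.1 w) : ℝ) + lam pp w
              + ∑ a, (lam pp (x a) +
                ((-((-(n₀ pp (x a) : ℤ)) / (ramIdx K (placeOf (pilotDataOfK D K) pp.1 (x a)) : ℤ)) : ℤ) : ℝ)))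
    (j : (thetaIndex (pilotDataOfK D K)).Label) (vQ : (thetaIndex (pilotDataOfK D K)).VQ)
    (hjv : ∀ (pp : Nat.Primes) (i : Fin (thetaIndex (pilotDataOfK D K)).lstar), vQ = .inr pp → j = Setting.labelSucc i → σ pp i) :
    (settingPrVolSharp (pilotDataOfK D K) hlog M archPk archSub Ψ act Mmod region n lat sig split qData tq t htq0 htq1).qRegion j vQ ⊆
      (settingPrVolSharp (pilotDataOfK D K) hlog M archPk archSub Ψ act Mmod region n lat sig split qData tq t htq0 htq1).thetaHull j vQ := by
  haveI hne : ∀ pp : Nat.Primes, Fact (pp : ℕ).Prime := fun pp => ⟨pp.2⟩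
  obtain ⟨ϖ, hϖ⟩ := exists_normUniformizers D
  refine qRegion_subset_thetaHull_settingPrVolSharp_of_slotReachOn (pilotDataOfK D K) hlog M archPk archSub Ψ act Mmod region n lat sig split
    qData tq t htq0 htq1 (fun pp x => ramIdx K (placeOf (pilotDataOfK D K) pp.1 x)) n₀ lam ϖ
    (fun pp i w => ((((i : ℕ) : ℤ) + 1) ^ 2) * mq pp w) mq
    (fun pp x => norm_qIdele_le_one_of_realises (pilotDataOfK D K) tq htq0 htq pp x) (fun pp x => one_le_ramIdx_placeOf D pp x) hϖ
    (fun pp x => ?_) hlam ht1 (fun pp i w hw => norm_thetaIdele_eq_zpow_of_realises D tq t htq0 ht0 ht htq mq pp i w (ϖ pp w) (hϖ pp w)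
      (hmq pp w hw)) (fun pp w hw => norm_qIdele_eq_zpow_of_realises D tq htq0 htq mq pp w (ϖ pp w) (hϖ pp w) (hmq pp w hw))
    σ hHσ j vQ hjv
  obtain ⟨u, hu, hu'⟩ := hn₀ pp x
  refine ⟨u, ?_, hu'⟩
  rw [zpow_of_norm_eq_rpow pp.2.pos (hϖ pp x)]
  exact hu

end Genuine

end Summit.ABC.IUTFork.Repair.RH2SigmaHull

end
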